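import Literature.NumberTheory.LFunctions.RayClassLSeriesStripBounds
import Literature.NumberTheory.LFunctions.RayClassLSeriesDirichlet
import Literature.NumberTheory.LFunctions.ClassGroupLFunctionLogDerivLeft
import HarnessLib

/-!
# `L'/L(−1/2 + it, χ)` for Hecke `L`-series of primitive ray class characters, uniformly in the field
# and the modulus

Topic `Literature/NumberTheory/LFunctions`; namespace `Literature.NumberTheory.LFunctions`.  Pure-proof
companion of `RayClassLSeriesStripBounds.lean` (the reflection formula `logDeriv_continuation_reflect`) and
`RayClassLSeriesDirichlet.lean` (`L'/L` on `Re s > 1`); the ray-class analogue (conductor `𝔣 = 𝔪`) of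
`ClassGroupLFunctionLogDerivLeft.lean`.  Everything here is PROVED; no definition and no named fact is
introduced.

* `exists_norm_logDeriv_continuation_left_le` — **Lagarias–Odlyzko Lemma 5.6 / Thorner–Zaman Lemma 2.6**:
  there is an ABSOLUTE `C > 0` such that for every number field `K`, every modulus `𝔪 ≠ 0`, every primitive
  ray class character `χ mod 𝔪` of sign type `p`, all entire continuations `L`, `L̄` of `L(χ, ·)`, `L(χ̄, ·)`
  and every real `t`:  `‖L'/L(−1/2 + it)‖ ≤ C (n_K + 1) (log(|d_K| 𝔑𝔪) + log(|t| + 4))`.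

Proof: `L'/L(w) = −log A − L_∞'/L_∞(w) − L_∞'/L_∞(1 − w) − L̄'/L̄(1 − w)` at `w = −1/2 + it`
(`1 − w = 3/2 − it`, where `L̄ ≠ 0` by the Euler product), Stirling for `ψ` on the six vertical lines
through `∓1/2 + a`, `3/2 + a`, `a ∈ {0, 1}` (real places of both parities) and `−1/2`, `3/2` (complex places),
and `‖L̄'/L̄(3/2 − it)‖ ≤ −ζ_K'/ζ_K(3/2)`.

## References

* J. C. Lagarias, A. M. Odlyzko, in *Algebraic Number Fields* (1977), Lemma 5.6. [LagariasOdlyzko1977]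
* J. Thorner, A. Zaman, ANT 13 (2019), Lemma 2.6. [ThornerZaman2019]
-/

noncomputable section

open Complex NumberField NumberField.InfinitePlace NumberField.Units IsDedekindDomain Filter Topology Set Metric
  Finset
open scoped NumberField nonZeroDivisors Real
open scoped Classical

namespace Literature.NumberTheory.LFunctions

/-! ### Stirling on two more vertical lines -/

/-- `‖Γ_ℝ'/Γ_ℝ(1/2 + it)‖, ‖Γ_ℝ'/Γ_ℝ(5/2 + it)‖ ≤ A + log(|t| + 4)` for an absolute `A ≥ 0`. [folklore] -/
private theorem exists_gammaℝ_shift_logDeriv_bound :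
    ∃ A : ℝ, 0 ≤ A ∧ ∀ t : ℝ,
      ‖logDeriv Gammaℝ (1 / 2 + t * I)‖ ≤ A + Real.log (|t| + 4) ∧
      ‖logDeriv Gammaℝ (5 / 2 + t * I)‖ ≤ A + Real.log (|t| + 4) := by
  obtain ⟨C₁, hC₁⟩ := Literature.Analysis.SpecialFunctions.Complex.exists_norm_digamma_vertical_le
    (a := 1 / 4) (by norm_num)
  obtain ⟨C₂, hC₂⟩ := Literature.Analysis.SpecialFunctions.Complex.exists_norm_digamma_vertical_le
    (a := 5 / 4) (by norm_num)
  have hC₁0 : 0 ≤ C₁ := by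
    have := (norm_nonneg _).trans (hC₁ 0); simpa using this
  have hC₂0 : 0 ≤ C₂ := by
    have := (norm_nonneg _).trans (hC₂ 0); simpa using this
  set Lπ : ℝ := ‖Complex.log π‖ with hLπ
  have hLπ0 : 0 ≤ Lπ := norm_nonneg _
  have hn2 : ‖(2 : ℂ)‖ = 2 := by simp
  have key : ∀ (a : ℝ) (C : ℝ), 0 < a → (∀ y : ℝ, ‖digamma (a + y * I)‖ ≤ C + Real.log (1 + |y|)) →
      ∀ t : ℝ, ‖logDeriv Gammaℝ (((2 * a : ℝ) : ℂ) + t * I)‖ ≤ Lπ / 2 + C / 2 + Real.log (|t| + 4) := by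
    intro a C ha hC t
    have hpole : ∀ m : ℕ, ((((2 * a : ℝ) : ℂ) + t * I) : ℂ) / 2 ≠ -m := fun m h ↦ by
      have := congrArg Complex.re h; simp at this; linarith [m.cast_nonneg (α := ℝ)]
    rw [logDeriv_Gammaℝ hpole]
    set q : ℂ := (a : ℂ) + ((t / 2 : ℝ) : ℂ) * I with hq
    have hqt : ((((2 * a : ℝ) : ℂ) + t * I) : ℂ) / 2 = q := by rw [hq]; push_cast; ring
    rw [hqt]
    have hψ : ‖Complex.digamma q‖ ≤ C + Real.log (1 + |t / 2|) := hC (t / 2)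
    have hy : |t / 2| ≤ |t| + 3 := by rw [abs_div, abs_two]; linarith [abs_nonneg t]
    have hlog := NumberField.log_one_add_le_log_add_four hy
    have hlog0 : 0 ≤ Real.log (|t| + 4) := Real.log_nonneg (by linarith [abs_nonneg t])
    have e1 : ‖-Complex.log π / 2‖ = Lπ / 2 := by rw [norm_div, norm_neg, hn2]
    have e2 : ‖Complex.digamma q / 2‖ = ‖Complex.digamma q‖ / 2 := by rw [norm_div, hn2]
    calc ‖-Complex.log π / 2 + Complex.digamma q / 2‖
        ≤ ‖-Complex.log π / 2‖ + ‖Complex.digamma q / 2‖ := norm_add_le _ _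
      _ ≤ Lπ / 2 + (C + Real.log (|t| + 4)) / 2 := by rw [e1, e2]; linarith
      _ ≤ _ := by linarith
  refine ⟨Lπ / 2 + C₁ / 2 + C₂ / 2, by positivity, fun t ↦ ⟨?_, ?_⟩⟩
  · have h := key (1 / 4) C₁ (by norm_num) hC₁ t
    have e : (((2 * (1 / 4) : ℝ) : ℂ) + t * I : ℂ) = 1 / 2 + t * I := by push_cast; ring
    rw [e] at h
    linarith
  · have h := key (5 / 4) C₂ (by norm_num) hC₂ t
    have e : (((2 * (5 / 4) : ℝ) : ℂ) + t * I : ℂ) = 5 / 2 + t * I := by push_cast; ring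
    rw [e] at h
    linarith

/-! ### The ray class gamma factor at `−1/2 + it` and `3/2 + it` -/

variable {K : Type*} [Field K] [NumberField K]

omit [NumberField K] in
/-- `2 · (half weight) ∈ {0, 1}`. [folklore] -/
private theorem exists_two_mul_halfWeight_eq' (p : Finset {w : InfinitePlace K // IsReal w})
    (w : {w : InfinitePlace K // IsReal w}) :
    ∃ c : ℤ, (c = 0 ∨ c = 1) ∧ (2 * (NumberField.halfWeight K p w.1 : ℂ)) = (c : ℂ) := by
  unfold NumberField.halfWeight
  rw [dif_pos w.2]
  split_ifs
  · exact ⟨1, Or.inr rfl, by push_cast; ring⟩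
  · exact ⟨0, Or.inl rfl, by push_cast; ring⟩

omit [NumberField K] in
/-- Each real factor `Γ_ℝ(s + 2a_v)` is differentiable and non-zero at `s ∉ ℤ`. [folklore] -/
private theorem gammaℝ_shift_differentiableAt_ne_zero' (p : Finset {w : InfinitePlace K // IsReal w}) {s : ℂ}
    (hs : ∀ n : ℤ, s ≠ n) (w : {w : InfinitePlace K // IsReal w}) :
    DifferentiableAt ℂ (fun z : ℂ ↦ Gammaℝ (z + 2 * (NumberField.halfWeight K p w.1 : ℂ))) s ∧
      Gammaℝ (s + 2 * (NumberField.halfWeight K p w.1 : ℂ)) ≠ 0 := by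
  obtain ⟨c, -, hc⟩ := exists_two_mul_halfWeight_eq' p w
  have hsc : ∀ n : ℤ, s + 2 * (NumberField.halfWeight K p w.1 : ℂ) ≠ n := by
    rw [hc]; exact fun n h ↦ hs (n - c) (by push_cast; linear_combination h)
  have h2 : ∀ m : ℕ, (s + 2 * (NumberField.halfWeight K p w.1 : ℂ)) / 2 ≠ -m :=
    fun m h ↦ hsc (-(2 * m)) (by push_cast; linear_combination 2 * h)
  have hd : DifferentiableAt ℂ Gammaℝ (s + 2 * (NumberField.halfWeight K p w.1 : ℂ)) :=
    (RealZeros.hasDerivAt_Gammaℝ h2).differentiableAt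
  refine ⟨hd.comp s (differentiableAt_id.add_const _), ?_⟩
  rw [Ne, Gammaℝ_eq_zero_iff]
  rintro ⟨m, hm⟩
  exact hsc (-(2 * m)) (by rw [hm]; push_cast; ring)

omit [NumberField K] in
/-- `Γ_ℂ` is differentiable and non-zero at `s ∉ ℤ`. [folklore] -/
private theorem gammaℂ_differentiableAt_ne_zero' {s : ℂ} (hs : ∀ n : ℤ, s ≠ n) :
    DifferentiableAt ℂ Gammaℂ s ∧ Gammaℂ s ≠ 0 := by
  have hsN : ∀ m : ℕ, s ≠ -m := NumberField.ne_neg_nat_of_ne_int hs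
  refine ⟨NumberField.differentiableAt_Gammaℂ hsN, ?_⟩
  rw [Gammaℂ_def]
  refine mul_ne_zero (mul_ne_zero two_ne_zero ?_) (Complex.Gamma_ne_zero hsN)
  rw [Ne, Complex.cpow_eq_zero_iff]
  exact fun h ↦ (mul_ne_zero two_ne_zero (by exact_mod_cast Real.pi_ne_zero)) h.1

/-- **`L_∞'/L_∞(s) = Σ_{v real} Γ_ℝ'/Γ_ℝ(s + 2a_v) + r₂ Γ_ℂ'/Γ_ℂ(s)`** off the integers. [folklore] -/
private theorem logDeriv_rayClassGammaFactor' (p : Finset {w : InfinitePlace K // IsReal w}) {s : ℂ}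
    (hs : ∀ n : ℤ, s ≠ n) :
    logDeriv (rayClassGammaFactor K p) s =
      ∑ w : {w : InfinitePlace K // IsReal w}, logDeriv Gammaℝ (s + 2 * (NumberField.halfWeight K p w.1 : ℂ)) +
        ∑ _w : {w : InfinitePlace K // IsComplex w}, logDeriv Gammaℂ s := by
  obtain ⟨hℂd, hℂ0⟩ := gammaℂ_differentiableAt_ne_zero' hs
  have hR := fun w ↦ gammaℝ_shift_differentiableAt_ne_zero' p hs w
  have hfun : rayClassGammaFactor K p = fun s ↦
      (∏ w : {w : InfinitePlace K // IsReal w}, Gammaℝ (s + 2 * (NumberField.halfWeight K p w.1 : ℂ))) *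
        ∏ _w : {w : InfinitePlace K // IsComplex w}, Gammaℂ s := by
    funext s; rw [rayClassGammaFactor]
  rw [hfun,
    logDeriv_mul (f := fun z ↦ ∏ w : {w : InfinitePlace K // IsReal w},
        Gammaℝ (z + 2 * (NumberField.halfWeight K p w.1 : ℂ)))
      (g := fun z ↦ ∏ _w : {w : InfinitePlace K // IsComplex w}, Gammaℂ z) s
      (prod_ne_zero_iff.2 fun w _ ↦ (hR w).2) (prod_ne_zero_iff.2 fun _ _ ↦ hℂ0)
      (DifferentiableAt.fun_finsetProd fun w _ ↦ (hR w).1) (DifferentiableAt.fun_finsetProd fun _ _ ↦ hℂd),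
    logDeriv_prod (s := univ) (f := fun (w : {w : InfinitePlace K // IsReal w}) (z : ℂ) ↦
        Gammaℝ (z + 2 * (NumberField.halfWeight K p w.1 : ℂ))) (x := s) (fun w _ ↦ (hR w).2)
      (fun w _ ↦ (hR w).1),
    logDeriv_prod (s := univ) (f := fun (_w : {w : InfinitePlace K // IsComplex w}) (z : ℂ) ↦ Gammaℂ z) (x := s)
      (fun _ _ ↦ hℂ0) (fun _ _ ↦ hℂd)]
  congr 1
  refine sum_congr rfl fun w _ ↦ ?_
  rw [logDeriv_apply, logDeriv_apply, deriv_comp_add_const]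

/-- **`‖L_∞'/L_∞(−1/2 + it)‖, ‖L_∞'/L_∞(3/2 + it)‖ ≤ n_K (A + log(|t| + 4))`** with an absolute `A ≥ 0`
(`r₁ + r₂ ≤ n_K`). [folklore] -/
private theorem exists_rayGammaFactor_logDeriv_bound :
    ∃ A : ℝ, 0 ≤ A ∧ ∀ (K : Type) [Field K] [NumberField K] (p : Finset {w : InfinitePlace K // IsReal w}) (t : ℝ),
      ‖logDeriv (rayClassGammaFactor K p) (-1 / 2 + t * I)‖ ≤ Module.finrank ℚ K * (A + Real.log (|t| + 4)) ∧
      ‖logDeriv (rayClassGammaFactor K p) (3 / 2 + t * I)‖ ≤ Module.finrank ℚ K * (A + Real.log (|t| + 4)) := by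
  obtain ⟨A₁, hA₁, hb₁⟩ := NumberField.exists_gammaFactor_logDeriv_bound
  obtain ⟨A₂, hA₂, hb₂⟩ := exists_gammaℝ_shift_logDeriv_bound
  refine ⟨A₁ + A₂, by positivity, fun K _ _ p t ↦ ?_⟩
  have ht4 : 0 ≤ Real.log (|t| + 4) := Real.log_nonneg (by linarith [abs_nonneg t])
  obtain ⟨h1, h2, h3, h4⟩ := hb₁ t
  obtain ⟨h5, h6⟩ := hb₂ t
  have hrank : ((univ : Finset {w : InfinitePlace K // IsReal w}).card : ℝ) +
      ((univ : Finset {w : InfinitePlace K // IsComplex w}).card : ℝ) ≤ Module.finrank ℚ K := by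
    have h := card_add_two_mul_card_eq_rank K
    rw [nrRealPlaces, nrComplexPlaces] at h
    rw [card_univ, card_univ]
    have : ((Fintype.card {w : InfinitePlace K // IsReal w} : ℕ) : ℝ) +
        2 * (Fintype.card {w : InfinitePlace K // IsComplex w} : ℕ) = Module.finrank ℚ K := by exact_mod_cast h
    linarith [(Fintype.card {w : InfinitePlace K // IsComplex w}).cast_nonneg (α := ℝ)]
  -- both points are non-integers
  have key : ∀ (s : ℂ), (∀ n : ℤ, s ≠ n) →
      (∀ w : {w : InfinitePlace K // IsReal w},
        ‖logDeriv Gammaℝ (s + 2 * (NumberField.halfWeight K p w.1 : ℂ))‖ ≤ A₁ + A₂ + Real.log (|t| + 4)) →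
      ‖logDeriv Gammaℂ s‖ ≤ A₁ + A₂ + Real.log (|t| + 4) →
      ‖logDeriv (rayClassGammaFactor K p) s‖ ≤ Module.finrank ℚ K * (A₁ + A₂ + Real.log (|t| + 4)) := by
    intro s hs hRe hCo
    rw [logDeriv_rayClassGammaFactor' p hs]
    calc ‖∑ w : {w : InfinitePlace K // IsReal w}, logDeriv Gammaℝ (s + 2 * (NumberField.halfWeight K p w.1 : ℂ)) +
          ∑ _w : {w : InfinitePlace K // IsComplex w}, logDeriv Gammaℂ s‖
        ≤ ∑ w : {w : InfinitePlace K // IsReal w}, ‖logDeriv Gammaℝ (s + 2 * (NumberField.halfWeight K p w.1 : ℂ))‖ +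
          ∑ _w : {w : InfinitePlace K // IsComplex w}, ‖logDeriv Gammaℂ s‖ :=
          (norm_add_le _ _).trans (add_le_add (norm_sum_le _ _) (norm_sum_le _ _))
      _ ≤ ∑ _w : {w : InfinitePlace K // IsReal w}, (A₁ + A₂ + Real.log (|t| + 4)) +
          ∑ _w : {w : InfinitePlace K // IsComplex w}, (A₁ + A₂ + Real.log (|t| + 4)) :=
          add_le_add (sum_le_sum fun w _ ↦ hRe w) (sum_le_sum fun _ _ ↦ hCo)
      _ = (((univ : Finset {w : InfinitePlace K // IsReal w}).card : ℝ) +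
          ((univ : Finset {w : InfinitePlace K // IsComplex w}).card : ℝ)) * (A₁ + A₂ + Real.log (|t| + 4)) := by
          rw [sum_const, sum_const, nsmul_eq_mul, nsmul_eq_mul]; ring
      _ ≤ Module.finrank ℚ K * (A₁ + A₂ + Real.log (|t| + 4)) :=
          mul_le_mul_of_nonneg_right hrank (by positivity)
  have hw : ∀ n : ℤ, (-1 / 2 + t * I : ℂ) ≠ n := fun n h ↦ by
    have := congrArg Complex.re h; simp at this
    have h2 : (2 * n : ℤ) = -1 := by exact_mod_cast (by linarith : (2 * n : ℝ) = -1)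
    omega
  have hs : ∀ n : ℤ, (3 / 2 + t * I : ℂ) ≠ n := fun n h ↦ by
    have := congrArg Complex.re h; simp at this
    have h2 : (2 * n : ℤ) = 3 := by exact_mod_cast (by linarith : (2 * n : ℝ) = 3)
    omega
  refine ⟨?_, ?_⟩
  · refine key _ hw (fun w ↦ ?_) (by linarith)
    obtain ⟨c, hc01, hc⟩ := exists_two_mul_halfWeight_eq' p w
    rcases hc01 with h0 | h1'
    · rw [hc, h0]; push_cast; rw [add_zero]; linarith
    · rw [hc, h1']; push_cast
      rw [show (-1 / 2 + t * I + 1 : ℂ) = 1 / 2 + t * I by ring]; linarith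
  · refine key _ hs (fun w ↦ ?_) (by linarith)
    obtain ⟨c, hc01, hc⟩ := exists_two_mul_halfWeight_eq' p w
    rcases hc01 with h0 | h1'
    · rw [hc, h0]; push_cast; rw [add_zero]; linarith
    · rw [hc, h1']; push_cast
      rw [show (3 / 2 + t * I + 1 : ℂ) = 5 / 2 + t * I by ring]; linarith

/-! ### The bound -/

/-- **Lagarias–Odlyzko Lemma 5.6 for primitive ray class characters, uniformly in the field and the
modulus**: there is an ABSOLUTE `C > 0` such that for every number field `K`, every modulus `𝔪 ≠ 0`,
every primitive ray class character `χ mod 𝔪` of sign type `p`, all entire continuations `L`, `L̄` of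
`L(χ, ·)`, `L(χ̄, ·)` and every real `t`:
`‖L'/L(−1/2 + it)‖ ≤ C (n_K + 1) (log(|d_K| 𝔑𝔪) + log(|t| + 4))`.
[cite: LagariasOdlyzko1977, Lemma 5.6] [cite: ThornerZaman2019, Lemma 2.6] -/
theorem exists_norm_logDeriv_continuation_left_le :
    ∃ C : ℝ, 0 < C ∧ ∀ (K : Type) [Field K] [NumberField K] (𝔪 : Ideal (𝓞 K))
      (ψ : HeightOneSpectrum (𝓞 K) → ℂ) (p : Finset {w : InfinitePlace K // IsReal w}),
      IsRayClassCharacter 𝔪 ψ → IsPrimitive 𝔪 ψ → IsSignType 𝔪 ψ p → 𝔪 ≠ ⊥ →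
      ∀ (L L' : ℂ → ℂ), Differentiable ℂ L → (∀ s : ℂ, 1 < s.re → L s = rayClassLSeries 𝔪 ψ s) →
        Differentiable ℂ L' → (∀ s : ℂ, 1 < s.re → L' s = rayClassLSeries 𝔪 (star ψ) s) →
      ∀ t : ℝ, ‖logDeriv L (-1 / 2 + t * I)‖ ≤
        C * (Module.finrank ℚ K + 1) * (Real.log (|(discr K : ℝ)| * (Ideal.absNorm 𝔪 : ℝ)) + Real.log (|t| + 4)) := by
  obtain ⟨A, hA, hb⟩ := exists_rayGammaFactor_logDeriv_bound
  refine ⟨2 * A + 544326, by positivity, fun K _ _ 𝔪 ψ p hψ hprim hp h𝔪 L L' hL hLs hL' hL's t ↦ ?_⟩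
  set n : ℕ := Module.finrank ℚ K with hn
  set A' : ℝ := |(discr K : ℝ)| * (Ideal.absNorm 𝔪 : ℝ) with hA'
  have hd1 : (1 : ℝ) ≤ |(discr K : ℝ)| := by
    have := Int.one_le_abs (discr_ne_zero K)
    rw [← Int.cast_abs]; exact_mod_cast this
  have hN1 : (1 : ℝ) ≤ (Ideal.absNorm 𝔪 : ℝ) := by
    exact_mod_cast Nat.one_le_iff_ne_zero.mpr (by rwa [ne_eq, Ideal.absNorm_eq_zero_iff])
  have hdA : Real.log |(discr K : ℝ)| ≤ Real.log A' := by
    rw [hA']; exact Real.log_le_log (by linarith) (le_mul_of_one_le_right (by linarith) hN1)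
  have hdnat : Real.log ((discr K).natAbs : ℝ) = Real.log |(discr K : ℝ)| := by
    rw [Nat.cast_natAbs, Int.cast_abs]
  have hlogd : 0 ≤ Real.log |(discr K : ℝ)| := Real.log_nonneg hd1
  have hlogA' : 0 ≤ Real.log A' := hlogd.trans hdA
  set ℒ : ℝ := Real.log A' + Real.log (|t| + 4) with hℒ
  have hℓ1 : 1 ≤ Real.log (|t| + 4) := ClassicalZFRData.one_le_log_tau t
  have hℒ1 : 1 ≤ ℒ := by linarith
  have hlog4 : Real.log 4 ≤ Real.log (|t| + 4) := Real.log_le_log (by norm_num) (by linarith [abs_nonneg t])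
  -- the points
  set w : ℂ := -1 / 2 + t * I with hw
  have hwZ : ∀ k : ℤ, w ≠ k := fun k h ↦ by
    have := congrArg Complex.re h; simp [hw] at this
    have h2 : (2 * k : ℤ) = -1 := by exact_mod_cast (by linarith : (2 * k : ℝ) = -1)
    omega
  have e1w : 1 - w = 3 / 2 + (-t) * I := by rw [hw]; ring
  have hre : (1 - w).re = 3 / 2 := by rw [e1w]; simp
  -- `L̄(3/2 - it) ≠ 0` (Euler product)
  have hL'0 : L' (1 - w) ≠ 0 := by
    have h32 : 1 < (1 - w).re := by rw [hre]; norm_num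
    have h := exp_neg_finrank_div_le_norm_rayClassLSeries h𝔪 (fun v hv ↦ (hψ.star.norm_eq_one v hv).le) h32
    intro h0
    rw [← hL's _ h32, h0, norm_zero] at h
    exact absurd h (not_le.mpr (Real.exp_pos _))
  obtain ⟨-, hrefl⟩ := logDeriv_continuation_reflect hψ hprim hp h𝔪 hL hLs hL' hL's hwZ hL'0
  -- the three terms
  obtain ⟨hγ1, hγ2'⟩ := hb K p t
  have hγ2 : ‖logDeriv (rayClassGammaFactor K p) (1 - w)‖ ≤ n * (A + Real.log (|t| + 4)) := by
    obtain ⟨-, h⟩ := hb K p (-t)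
    rw [abs_neg] at h
    rw [e1w]; push_cast at h ⊢; exact h
  have hLb : ‖logDeriv L' (1 - w)‖ ≤ 1 / ((1 - w).re - 1) + 77760 * (5 * Module.finrank ℚ K + 2) *
      (Real.log ((discr K).natAbs : ℝ) + Real.log 4) :=
    norm_logDeriv_continuation_le_of_one_lt_re h𝔪 (fun v hv ↦ (hψ.star.norm_eq_one v hv).le) hL's
      (by rw [hre]; norm_num) (by rw [hre]; norm_num)
  rw [hre, hdnat, show (1 : ℝ) / (3 / 2 - 1) = 2 by norm_num] at hLb
  have hlogAn : ‖(-(Real.log A' : ℂ))‖ = Real.log A' := by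
    rw [norm_neg, Complex.norm_real, Real.norm_of_nonneg hlogA']
  have hn0 : (0 : ℝ) ≤ n := n.cast_nonneg
  rw [hrefl]
  calc ‖-(Real.log A' : ℂ) - logDeriv (rayClassGammaFactor K p) w - logDeriv (rayClassGammaFactor K p) (1 - w) -
        logDeriv L' (1 - w)‖
      ≤ ‖-(Real.log A' : ℂ)‖ + ‖logDeriv (rayClassGammaFactor K p) w‖ +
          ‖logDeriv (rayClassGammaFactor K p) (1 - w)‖ + ‖logDeriv L' (1 - w)‖ :=
        (norm_sub_le _ _).trans (add_le_add ((norm_sub_le _ _).trans (add_le_add (norm_sub_le _ _) le_rfl)) le_rfl)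
    _ ≤ Real.log A' + n * (A + Real.log (|t| + 4)) + n * (A + Real.log (|t| + 4)) +
          (2 + 77760 * (5 * n + 2) * (Real.log |(discr K : ℝ)| + Real.log 4)) := by
        rw [hlogAn]; gcongr
    _ ≤ (2 * A + 544326) * (n + 1) * ℒ := by
        have h1 : Real.log A' ≤ ℒ := by linarith
        have h2 : Real.log (|t| + 4) ≤ ℒ := by linarith
        have h3 : (2 : ℝ) ≤ 2 * ℒ := by linarith
        have h4 : Real.log |(discr K : ℝ)| + Real.log 4 ≤ ℒ := by linarith
        have h5 : 77760 * (5 * n + 2) * (Real.log |(discr K : ℝ)| + Real.log 4) ≤ 77760 * (5 * n + 2) * ℒ :=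
          mul_le_mul_of_nonneg_left h4 (by positivity)
        nlinarith [mul_nonneg hn0 hA, mul_nonneg hn0 (by linarith : (0 : ℝ) ≤ ℒ),
          mul_nonneg hA (by linarith : (0 : ℝ) ≤ ℒ)]

end Literature.NumberTheory.LFunctions
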